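import Summits.QuantumFields.BalabanUV.T4Continuum.Support.NE7CentredRepresentative
import Literature.MathematicalPhysics.QuantumFieldTheory.Balaban1983to89.B4Sect5Torus
import HarnessLib

/-!
# NE7SmoothProductCutoff — A PERIODIC CUTOFF WITH BOUNDED FIRST AND SECOND LATTICE DIFFERENCES (the `χ` of the torus road's cut-off representative `χ•Ã`):
# per coordinate the DOUBLE BOX AVERAGE of width `m` of the indicator of a torus interval (`|δ| ≤ 1∕m`, `|δ²| ≤ 2∕m²` by two telescopings — no calculus),
# then the PRODUCT over the `d + 1` coordinates (`|δ| ≤ 1∕m`, pure and mixed `|δ²| ≤ 2∕m²`); plateau `1` on the torus sup-ball of radius `a − m + 1`, support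
# inside the ball of radius `a + m`, values in `[0,1]`, period `P`

Cell `pub-balaban`, rung (B)+1 sub-cell t4, lineage `b2b-balaban-t4-ne7-p1` (CRUX PROVER NE7 #1 = OWNER of row NE7), generation 90; memo
`t4/b2b-balaban-t4-ne7-p1-g90/DEFECT-FAR.md` §4 (instantiation I1).  File F276 (over lit-balaban's `B4TorusKernel.MultiPeriod.circAbs` (`circAbs_add_mul`, `circAbs_le_abs`,
`circAbs_nonneg`) and `B4Sect5Torus.circAbs_add_le`, `Finset.sum_range_sub`).

WHY (memo §1, §4).  The repaired defect supplier F275 `NE7StraightDefectAssemblyV2.abs_dAction_cutoffRep_le_twoRegion_straight` charges the cutoff `g` of the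
representative `g•Ã` through its FIRST differences `c₁` (against `α₁`) and its SECOND differences `c₂` (against `α₀`): with `α₀ ≍ Rr∕M` the road's line needs
`c₂ = O((RM)⁻²)` — a piecewise-linear cutoff (`c₂ ≍ 1∕(RM)` at its kinks) is one power of `M` short.  THIS FILE builds a cutoff with `c₁ = 1∕m`, `c₂ = 2∕m²` at site
scale `m ≍ RM`, periodic on the torus of period `P = N·M`, by pure summation bookkeeping.
WHAT ([folklore]; 0 def, 0 sorry; dimension `d + 1`).
§1 `circAbs_add_int_le`, `circAbs_le_circAbs_add_int` — `circAbs(x + s) ≤ circAbs x + |s|` and back.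
§2 **`exists_profile1D`** — for `P, m ≥ 1`, `a, c ∈ ℤ`: `∃ h : ℤ → ℝ`, `P`-periodic, `0 ≤ h ≤ 1`, `|h(x+1) − h(x)| ≤ 1∕m`, `|(h(x+1) − h(x)) − (h(x) − h(x−1))| ≤ 2∕m²`,
   `h(x) = 1` if `circAbs_P(x − c) + (m − 1) ≤ a`, `h(x) = 0` if `a + m ≤ circAbs_P(x − c)` (the double box average `m⁻²Σ_{i,j<m} 𝟙[circAbs_P(x − m + 1 + i + j − c) ≤ a]`).
§3 `abs_prod_sub_prod_le` — products of `[0,1]`-valued families differing in one coordinate differ by at most that coordinate's difference.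
§4 **`exists_smooth_cutoff`** — `∃ g : Site (d+1) → ℝ`, `P`-periodic, `0 ≤ g ≤ 1`, `|g(z+e_κ) − g(z)| ≤ 1∕m`,
   `|(g(z+e_κ) − g(z)) − (g(z−e_τ+e_κ) − g(z−e_τ))| ≤ 2∕m²` (all `κ, τ`), `g(z) = 1` if every `circAbs_P(z_i − c_i) + (m−1) ≤ a`, `g(z) = 0` if some
   `a + m ≤ circAbs_P(z_i − c_i)` (the product `Π_i h_i(z_i)` of §2's profiles).
HONEST FRAMING (page 1): elementary lattice bookkeeping; nothing of Bałaban's asserted; NOT (APE), NOT ONE-STEP, NOT NE7; spine 0∕9; finite T⁴ rung (B)+1 — NOT infinite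
volume, NOT mass gap, NOT `BetaPertH`, NOT Clay.  Continuum YM on T⁴ ⇐ BetaPertH ∧ nine spine estimates (0/9 proved); BetaPertH ⇐ (D1) ∧ (D4) ∧ CAP+tail; G-an2-4 gates
asym, D1 and NE2/3/4.
-/

set_option autoImplicit false

open scoped BigOperators
open Finset

namespace Summit.QuantumFields.BalabanUV.T4Continuum.NE7SmoothProductCutoff

open Literature.MathematicalPhysics.QuantumFieldTheory.Balaban1983to89
open B7Prop1Explicit
open B4TorusKernel.MultiPeriod (circAbs circAbs_add_mul circAbs_le_abs circAbs_nonneg)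
open B4Sect5Torus (circAbs_add_le)

noncomputable section

variable {d : ℕ}

/-! ## §1 `circAbs` under integer shifts -/

/-- `circAbs_P(x + s) ≤ circAbs_P(x) + |s|`. [folklore] -/
theorem circAbs_add_int_le {P : ℕ} (hP : 1 ≤ P) (x s : ℤ) : circAbs P (x + s) ≤ circAbs P x + |s| :=
  (circAbs_add_le hP x s).trans (by have := circAbs_le_abs hP s; omega)

/-- `circAbs_P(x) ≤ circAbs_P(x + s) + |s|`. [folklore] -/
theorem circAbs_le_circAbs_add_int {P : ℕ} (hP : 1 ≤ P) (x s : ℤ) : circAbs P x ≤ circAbs P (x + s) + |s| := by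
  have h := circAbs_add_int_le hP (x + s) (-s)
  rw [add_neg_cancel_right, abs_neg] at h
  exact h

/-! ## §2 The one-dimensional profile: a double box average of a torus-interval indicator -/

/-- **THE ONE-DIMENSIONAL `C^{1,1}` PROFILE** (statement in the module docstring §2). [folklore] -/
theorem exists_profile1D {P m : ℕ} (hP : 1 ≤ P) (hm : 1 ≤ m) (a c : ℤ) :
    ∃ h : ℤ → ℝ, (∀ x : ℤ, h (x + P) = h x) ∧ (∀ x : ℤ, 0 ≤ h x ∧ h x ≤ 1) ∧
      (∀ x : ℤ, |h (x + 1) - h x| ≤ 1 / m) ∧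
      (∀ x : ℤ, |(h (x + 1) - h x) - (h x - h (x - 1))| ≤ 2 / (m : ℝ) ^ 2) ∧
      (∀ x : ℤ, circAbs P (x - c) + ((m : ℤ) - 1) ≤ a → h x = 1) ∧
      (∀ x : ℤ, a + m ≤ circAbs P (x - c) → h x = 0) := by
  classical
  -- the torus-interval indicator
  obtain ⟨ind, hind⟩ : ∃ ind : ℤ → ℝ, ∀ x, ind x = if circAbs P (x - c) ≤ a then 1 else 0 := ⟨_, fun _ => rfl⟩
  have hind01 : ∀ x, 0 ≤ ind x ∧ ind x ≤ 1 := fun x => by rw [hind]; split_ifs <;> norm_num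
  have hindP : ∀ x, ind (x + P) = ind x := fun x => by
    rw [hind, hind, show x + (P : ℤ) - c = (x - c) + P * 1 by ring, circAbs_add_mul]
  have hind_sub : ∀ x y, |ind x - ind y| ≤ 1 := fun x y => by
    have hx := hind01 x; have hy := hind01 y; rw [abs_le]; constructor <;> linarith
  have hmpos : (0 : ℝ) < m := by exact_mod_cast (by omega : 0 < m)
  have hm2pos : (0 : ℝ) < (m : ℝ) ^ 2 := by positivity
  -- its double box average
  obtain ⟨h, hh⟩ : ∃ h : ℤ → ℝ, ∀ x, h x = (∑ i ∈ Finset.range m, ∑ j ∈ Finset.range m, ind (x - ((m : ℤ) - 1) + i + j)) / (m : ℝ) ^ 2 :=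
    ⟨_, fun _ => rfl⟩
  -- the first difference, inner sum telescoped
  have hδ : ∀ x : ℤ, h (x + 1) - h x = (∑ i ∈ Finset.range m, (ind (x + 1 + i) - ind (x - ((m : ℤ) - 1) + i))) / (m : ℝ) ^ 2 := by
    intro x
    rw [hh, hh, ← sub_div, ← Finset.sum_sub_distrib]
    congr 1
    refine Finset.sum_congr rfl fun i _ => ?_
    obtain ⟨F, hF⟩ : ∃ F : ℕ → ℝ, ∀ j, F j = ind (x - ((m : ℤ) - 1) + i + j) := ⟨_, fun _ => rfl⟩
    calc ∑ j ∈ Finset.range m, ind (x + 1 - ((m : ℤ) - 1) + i + j) - ∑ j ∈ Finset.range m, ind (x - ((m : ℤ) - 1) + i + j)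
        = ∑ j ∈ Finset.range m, (F (j + 1) - F j) := by
          rw [← Finset.sum_sub_distrib]
          refine Finset.sum_congr rfl fun j _ => ?_
          rw [hF, hF]
          congr 2; push_cast; ring
      _ = F m - F 0 := Finset.sum_range_sub F m
      _ = ind (x + 1 + i) - ind (x - ((m : ℤ) - 1) + i) := by
          rw [hF, hF]
          congr 2 <;> push_cast <;> ring
  refine ⟨h, ?_, ?_, ?_, ?_, ?_, ?_⟩
  · -- periodic
    intro x
    rw [hh, hh]
    refine congrArg (· / (m : ℝ) ^ 2) (Finset.sum_congr rfl fun i _ => Finset.sum_congr rfl fun j _ => ?_)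
    rw [show x + (P : ℤ) - ((m : ℤ) - 1) + i + j = (x - ((m : ℤ) - 1) + i + j) + P by ring, hindP]
  · -- values in `[0,1]`
    intro x
    rw [hh]
    constructor
    · exact div_nonneg (Finset.sum_nonneg fun i _ => Finset.sum_nonneg fun j _ => (hind01 _).1) hm2pos.le
    · rw [div_le_one hm2pos]
      calc ∑ i ∈ Finset.range m, ∑ j ∈ Finset.range m, ind (x - ((m : ℤ) - 1) + i + j)
          ≤ ∑ _i ∈ Finset.range m, ∑ _j ∈ Finset.range m, (1 : ℝ) :=
            Finset.sum_le_sum fun i _ => Finset.sum_le_sum fun j _ => (hind01 _).2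
        _ = (m : ℝ) ^ 2 := by rw [Finset.sum_const, Finset.card_range, Finset.sum_const, Finset.card_range, nsmul_eq_mul, nsmul_eq_mul]; ring
  · -- first differences
    intro x
    rw [hδ x, abs_div, abs_of_pos hm2pos, div_le_div_iff₀ hm2pos hmpos, one_mul]
    calc |∑ i ∈ Finset.range m, (ind (x + 1 + i) - ind (x - ((m : ℤ) - 1) + i))| * m
        ≤ (∑ i ∈ Finset.range m, |ind (x + 1 + i) - ind (x - ((m : ℤ) - 1) + i)|) * m :=
          mul_le_mul_of_nonneg_right (Finset.abs_sum_le_sum_abs _ _) hmpos.le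
      _ ≤ (∑ _i ∈ Finset.range m, (1 : ℝ)) * m := mul_le_mul_of_nonneg_right (Finset.sum_le_sum fun i _ => hind_sub _ _) hmpos.le
      _ = (m : ℝ) ^ 2 := by rw [Finset.sum_const, Finset.card_range, nsmul_eq_mul]; ring
  · -- second differences: telescope over `i`
    intro x
    have hprev := hδ (x - 1)
    rw [sub_add_cancel] at hprev
    rw [hδ x, hprev, ← sub_div, ← Finset.sum_sub_distrib]
    obtain ⟨G, hG⟩ : ∃ G : ℕ → ℝ, ∀ i, G i = ind (x + i) - ind (x - 1 - ((m : ℤ) - 1) + i) := ⟨_, fun _ => rfl⟩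
    have htel2 : ∑ i ∈ Finset.range m, ((ind (x + 1 + i) - ind (x - ((m : ℤ) - 1) + i)) - (ind (x + i) - ind (x - 1 - ((m : ℤ) - 1) + i)))
        = G m - G 0 := by
      rw [← Finset.sum_range_sub G m]
      refine Finset.sum_congr rfl fun i _ => ?_
      rw [hG, hG]
      congr 3 <;> push_cast <;> ring
    rw [htel2, abs_div, abs_of_pos hm2pos]
    refine div_le_div_of_nonneg_right ?_ hm2pos.le
    have h1 : |G m| ≤ 1 := by rw [hG]; exact hind_sub _ _
    have h2 : |G 0| ≤ 1 := by rw [hG]; exact hind_sub _ _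
    have h3 := abs_sub (G m) (G 0)
    linarith
  · -- plateau
    intro x hx
    rw [hh, div_eq_one_iff_eq hm2pos.ne']
    have hone : ∀ i ∈ Finset.range m, ∀ j ∈ Finset.range m, ind (x - ((m : ℤ) - 1) + i + j) = 1 := by
      intro i hi j hj
      rw [Finset.mem_range] at hi hj
      rw [hind, if_pos]
      have hs : |(-((m : ℤ) - 1) + i + j)| ≤ (m : ℤ) - 1 := by
        rw [abs_le]; constructor <;> omega
      have h' := circAbs_add_int_le hP (x - c) (-((m : ℤ) - 1) + i + j)
      rw [show x - c + (-((m : ℤ) - 1) + i + j) = x - ((m : ℤ) - 1) + i + j - c by ring] at h'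
      omega
    rw [Finset.sum_congr rfl fun i hi => Finset.sum_congr rfl fun j hj => hone i hi j hj,
      Finset.sum_const, Finset.card_range, Finset.sum_const, Finset.card_range, nsmul_eq_mul, nsmul_eq_mul]
    ring
  · -- outside the support
    intro x hx
    rw [hh, div_eq_zero_iff]
    left
    refine Finset.sum_eq_zero fun i hi => Finset.sum_eq_zero fun j hj => ?_
    rw [Finset.mem_range] at hi hj
    rw [hind, if_neg]
    have hs : |(-((m : ℤ) - 1) + i + j)| ≤ (m : ℤ) - 1 := by
      rw [abs_le]; constructor <;> omega
    have h' := circAbs_le_circAbs_add_int hP (x - c) (-((m : ℤ) - 1) + i + j)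
    rw [show x - c + (-((m : ℤ) - 1) + i + j) = x - ((m : ℤ) - 1) + i + j - c by ring] at h'
    omega

/-! ## §3 Products of `[0,1]`-valued families -/

/-- Two families agreeing off one index `τ`, the first `[0,1]`-valued, have products over any finite set differing by at most `|f τ − f′ τ|`. [folklore] -/
theorem abs_prod_sub_prod_le {ι : Type*} [DecidableEq ι] (s : Finset ι) (f f' : ι → ℝ) (hf : ∀ i, 0 ≤ f i ∧ f i ≤ 1) (τ : ι)
    (hagree : ∀ i, i ≠ τ → f i = f' i) : |∏ i ∈ s, f i - ∏ i ∈ s, f' i| ≤ |f τ - f' τ| := by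
  by_cases hτ : τ ∈ s
  · have h1 : ∏ i ∈ s, f i = f τ * ∏ i ∈ s.erase τ, f i := (Finset.mul_prod_erase _ _ hτ).symm
    have h2 : ∏ i ∈ s, f' i = f' τ * ∏ i ∈ s.erase τ, f i := by
      rw [← Finset.mul_prod_erase _ _ hτ]
      congr 1
      exact Finset.prod_congr rfl fun i hi => (hagree i (Finset.ne_of_mem_erase hi)).symm
    rw [h1, h2, ← sub_mul, abs_mul]
    have hR0 : 0 ≤ ∏ i ∈ s.erase τ, f i := Finset.prod_nonneg fun i _ => (hf i).1
    have hR1 : ∏ i ∈ s.erase τ, f i ≤ 1 := Finset.prod_le_one (fun i _ => (hf i).1) fun i _ => (hf i).2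
    rw [abs_of_nonneg hR0]
    exact mul_le_of_le_one_right (abs_nonneg _) hR1
  · have he : ∏ i ∈ s, f i = ∏ i ∈ s, f' i := Finset.prod_congr rfl fun i hi => hagree i (fun h => hτ (h ▸ hi))
    rw [he, sub_self, abs_zero]
    exact abs_nonneg _

/-- Products of `[0,1]`-valued families lie in `[0,1]`. [folklore] -/
theorem prod_mem_unit (f : Fin (d + 1) → ℝ) (hf : ∀ i, 0 ≤ f i ∧ f i ≤ 1) : 0 ≤ ∏ i, f i ∧ ∏ i, f i ≤ 1 :=
  ⟨Finset.prod_nonneg fun i _ => (hf i).1, Finset.prod_le_one (fun i _ => (hf i).1) fun i _ => (hf i).2⟩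

/-! ## §4 The product cutoff -/

/-- **THE PERIODIC `C^{1,1}` PRODUCT CUTOFF** (statement in the module docstring §4). [folklore] -/
theorem exists_smooth_cutoff {P m : ℕ} (hP : 1 ≤ P) (hm : 1 ≤ m) (a : ℤ) (c : Site (d + 1)) :
    ∃ g : Site (d + 1) → ℝ,
      (∀ (z : Site (d + 1)) (i : Fin (d + 1)), g (z + (P : ℤ) • e i) = g z) ∧
      (∀ z : Site (d + 1), 0 ≤ g z ∧ g z ≤ 1) ∧
      (∀ (z : Site (d + 1)) (κ : Fin (d + 1)), |g (z + e κ) - g z| ≤ 1 / m) ∧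
      (∀ (z : Site (d + 1)) (κ τ : Fin (d + 1)), |(g (z + e κ) - g z) - (g (z - e τ + e κ) - g (z - e τ))| ≤ 2 / (m : ℝ) ^ 2) ∧
      (∀ z : Site (d + 1), (∀ i, circAbs P (z i - c i) + ((m : ℤ) - 1) ≤ a) → g z = 1) ∧
      (∀ z : Site (d + 1), (∃ i, a + m ≤ circAbs P (z i - c i)) → g z = 0) := by
  classical
  -- one profile per coordinate
  have hprof := fun i : Fin (d + 1) => exists_profile1D hP hm a (c i)
  choose h hhP hh01 hh1 hh2 hhone hhzero using hprof
  have hmpos : (0 : ℝ) < m := by exact_mod_cast (by omega : 0 < m)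
  -- coordinates of shifted sites
  have he_self : ∀ (z : Site (d + 1)) (κ : Fin (d + 1)), (z + e κ) κ = z κ + 1 := fun z κ => by simp [e_apply]
  have he_ne : ∀ (z : Site (d + 1)) (κ i : Fin (d + 1)), i ≠ κ → (z + e κ) i = z i := fun z κ i hi => by simp [e_apply, hi]
  have hse_self : ∀ (z : Site (d + 1)) (κ : Fin (d + 1)), (z - e κ) κ = z κ - 1 := fun z κ => by simp [e_apply]
  have hse_ne : ∀ (z : Site (d + 1)) (κ i : Fin (d + 1)), i ≠ κ → (z - e κ) i = z i := fun z κ i hi => by simp [e_apply, hi]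
  refine ⟨fun z => ∏ i, h i (z i), ?_, ?_, ?_, ?_, ?_, ?_⟩
  · -- periodic
    intro z i
    refine Finset.prod_congr rfl fun j _ => ?_
    by_cases hj : j = i
    · subst hj; simp [e_apply, hhP]
    · simp [e_apply, hj]
  · exact fun z => prod_mem_unit _ fun i => hh01 i (z i)
  · -- first differences
    intro z κ
    refine (abs_prod_sub_prod_le Finset.univ (fun i => h i ((z + e κ) i)) (fun i => h i (z i)) (fun i => hh01 i _) κ
      (fun i hi => by show h i ((z + e κ) i) = h i (z i); rw [he_ne z κ i hi])).trans ?_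
    show |h κ ((z + e κ) κ) - h κ (z κ)| ≤ 1 / m
    rw [he_self]
    exact hh1 κ (z κ)
  · -- second differences: pure (`τ = κ`) and mixed
    intro z κ τ
    -- factor the `κ`-coordinate out of all four products
    obtain ⟨R, hRdef⟩ : ∃ R : Site (d + 1) → ℝ, ∀ w, R w = ∏ i ∈ Finset.univ.erase κ, h i (w i) := ⟨_, fun _ => rfl⟩
    have hR01 : ∀ w, 0 ≤ R w ∧ R w ≤ 1 := fun w => by
      rw [hRdef]
      exact ⟨Finset.prod_nonneg fun i _ => (hh01 i _).1, Finset.prod_le_one (fun i _ => (hh01 i _).1) fun i _ => (hh01 i _).2⟩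
    have hfac : ∀ w : Site (d + 1), ∏ i, h i (w i) = h κ (w κ) * R w := fun w => by
      rw [hRdef]; exact (Finset.mul_prod_erase _ _ (Finset.mem_univ κ)).symm
    have hrest : ∀ w : Site (d + 1), R (w + e κ) = R w := fun w => by
      rw [hRdef, hRdef]
      exact Finset.prod_congr rfl fun i hi => by rw [he_ne w κ i (Finset.ne_of_mem_erase hi)]
    have hdiff : ∀ w : Site (d + 1), ∏ i, h i ((w + e κ) i) - ∏ i, h i (w i) = (h κ (w κ + 1) - h κ (w κ)) * R w := by
      intro w
      rw [hfac (w + e κ), hfac w, hrest w, he_self, sub_mul]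
    rw [hdiff z, hdiff (z - e τ)]
    by_cases hτ : τ = κ
    · -- pure second difference along `κ`
      subst hτ
      have hRz : R (z - e τ) = R z := by
        rw [hRdef, hRdef]
        exact Finset.prod_congr rfl fun i hi => by rw [hse_ne z τ i (Finset.ne_of_mem_erase hi)]
      rw [hRz, hse_self, sub_add_cancel, ← sub_mul, abs_mul, abs_of_nonneg (hR01 z).1]
      exact (mul_le_of_le_one_right (abs_nonneg _) (hR01 z).2).trans (hh2 τ (z τ))
    · -- mixed: a first difference in `κ` times a first difference of `R` in `τ`
      have hκτ : κ ≠ τ := fun h' => hτ h'.symm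
      rw [hse_ne z τ κ hκτ, ← mul_sub, abs_mul]
      have hRd : |R z - R (z - e τ)| ≤ 1 / m := by
        rw [hRdef, hRdef]
        refine (abs_prod_sub_prod_le (Finset.univ.erase κ) (fun i => h i (z i)) (fun i => h i ((z - e τ) i)) (fun i => hh01 i _) τ
          (fun i hi => by show h i (z i) = h i ((z - e τ) i); rw [hse_ne z τ i hi])).trans ?_
        show |h τ (z τ) - h τ ((z - e τ) τ)| ≤ 1 / m
        rw [hse_self]
        have h' := hh1 τ (z τ - 1)
        rwa [sub_add_cancel] at h'
      calc |h κ (z κ + 1) - h κ (z κ)| * |R z - R (z - e τ)| ≤ (1 / m) * (1 / m) :=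
            mul_le_mul (hh1 κ (z κ)) hRd (abs_nonneg _) (by positivity)
        _ = 1 / (m : ℝ) ^ 2 := by ring
        _ ≤ 2 / (m : ℝ) ^ 2 := div_le_div_of_nonneg_right (by norm_num) (by positivity)
  · -- plateau
    intro z hz
    exact Finset.prod_eq_one fun i _ => hhone i (z i) (hz i)
  · -- outside the support
    rintro z ⟨i, hi⟩
    exact Finset.prod_eq_zero (Finset.mem_univ i) (hhzero i (z i) hi)

end

end Summit.QuantumFields.BalabanUV.T4Continuum.NE7SmoothProductCutoff
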